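import Mathlib
import HarnessLib
import HarnessLib.Audit
import Summits.AtomisticToContinuum.Statement
import Literature.MathematicalPhysics.QuantumLattice.XYOrder
import HarnessLib.Audit.Status.Attr

/-!
Route: BECBoundaryReservoir

DORMANT since 2026-08-23T04:20:26Z (reconciler: no traction for 5.9 d (last activity item-evidence-added at 2026-08-17T06:20:02Z); parked, not closed — `ledger route dormant route-AtomisticToContinuum-BECBoundaryReservoir --off` to reac) — unstaffed, not closed; items shared with open routes are served there. `ledger route dormant <id> --off` reactivates.

# Route BECBoundaryReservoir — boundary condensate reservoir — BEC equals penetration of coherence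
to the bulk (Lebowitz–Martin-Löf for bosons)

It suffices to show X = ShellPenetration ∧ ReservoirRemoval (card
boundary-reservoir-lebowitz-penetration, K1 and K3). Couple the
dilute gas in its Dirichlet box Λ_L to a CONDENSATE RESERVOIR OF FIXED STRENGTH SITTING ON THE
BOUNDARY and read the order parameter in
the bulk: the reservoir is the boundary shell S_w = {x ∈ Λ_L : dist_∞(x, ∂Λ_L) ≤ w} of the box
itself, condensed by fiat into its
normalised indicator mode g by the number-conserving rank-one pinning H_N ↦ H_N + κ Σ_i (1 −
|g⟩⟨g|_i) (κ, w fixed as L → ∞; stoquastic,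
so the ground state stays positive). ShellPenetration (K1): near-minimisers Ψ of the pinned energy
satisfy, for every unit ball B in
the bulk at distance ≥ w from the shell, |⟨1_B, γ_Ψ g⟩|² ≥ c·⟨g, γ_Ψ g⟩ > 0 — the coherence of the
bulk with the reservoir mode,
per reservoir particle, stays bounded below: "the boundary phase penetrates to the centre" (under
c-number substitution for the
reservoir mode this is |⟨a(x)⟩|² ≥ c). ReservoirRemoval (K3, ⟹): a macroscopic eigenvalue of γ for
the pinned near-minimisers at
density ρ < ρ₀(v) forces HasGroundStateBEC v ρ for the bare Dirichlet box. In between sits a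
provable Bessel step (support).
Lean: `(∀ v : ℝ → ENNReal,
Literature.MathematicalPhysics.QuantumManyBody.BoseGas.IsRepulsiveFiniteRange v → ∃ ρ₀ : ℝ, 0 < ρ₀ ∧
∀ ρ : ℝ, 0 < ρ → ρ < ρ₀ → ∃ w κ c : ℝ, 0 < w ∧ 0 < κ ∧ 0 < c ∧ ∀ᶠ n : ℕ in Filter.atTop, ∃ δ :
ENNReal, 0 < δ ∧ let L : ℝ := Literature.MathematicalPhysics.QuantumManyBody.BoseGas.sideLength ρ (n
+ 1); let g : EuclideanSpace ℝ (Fin 3) → ℂ := Set.indicator {x | (∀ k, x k ∈ Set.Ioo 0 L) ∧ ∃ k, x k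
≤ w ∨ L - w ≤ x k} (fun _ => ((Real.sqrt (L ^ 3 - (L - 2 * w) ^ 3))⁻¹ : ℂ)); ∀ Ψ :
Literature.MathematicalPhysics.QuantumManyBody.BoseGas.TrialState (n + 1) L,
Literature.MathematicalPhysics.QuantumManyBody.BoseGas.energy v Ψ + ENNReal.ofReal κ * ((n + 1 :
ENNReal) - Literature.MathematicalPhysics.QuantumManyBody.BoseGas.occupation (n + 1) g Ψ.ψ) ≤ (⨅ Φ :
Literature.MathematicalPhysics.QuantumManyBody.BoseGas.TrialState (n + 1) L,
Literature.MathematicalPhysics.QuantumManyBody.BoseGas.energy v Φ + ENNReal.ofReal κ * ((n + 1 :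
ENNReal) - Literature.MathematicalPhysics.QuantumManyBody.BoseGas.occupation (n + 1) g Φ.ψ)) + δ → 0
< Literature.MathematicalPhysics.QuantumManyBody.BoseGas.occupation (n + 1) g Ψ.ψ ∧ ∀ z :
EuclideanSpace ℝ (Fin 3), (∀ k, z k ∈ Set.Icc (2 * w + 1) (L - 2 * w - 1)) → c *
(Literature.MathematicalPhysics.QuantumManyBody.BoseGas.occupation (n + 1) g Ψ.ψ).toReal ≤ ‖(n + 1 :
ℂ) * ∫ Y : Fin n → EuclideanSpace ℝ (Fin 3), (∫ x in Metric.ball z 1, Ψ.ψ (Matrix.vecCons x Y)) *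
conj (∫ x, conj (g x) * Ψ.ψ (Matrix.vecCons x Y))‖ ^ 2) ∧ (∀ v : ℝ → ENNReal,
Literature.MathematicalPhysics.QuantumManyBody.BoseGas.IsRepulsiveFiniteRange v → ∃ ρ₀ : ℝ, 0 < ρ₀ ∧
∀ ρ w κ : ℝ, 0 < ρ → ρ < ρ₀ → 0 < w → 0 < κ → (∃ c : ℝ, 0 < c ∧ ∀ᶠ n : ℕ in Filter.atTop, ∃ δ :
ENNReal, 0 < δ ∧ let L : ℝ := Literature.MathematicalPhysics.QuantumManyBody.BoseGas.sideLength ρ (n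
+ 1); let g : EuclideanSpace ℝ (Fin 3) → ℂ := Set.indicator {x | (∀ k, x k ∈ Set.Ioo 0 L) ∧ ∃ k, x k
≤ w ∨ L - w ≤ x k} (fun _ => ((Real.sqrt (L ^ 3 - (L - 2 * w) ^ 3))⁻¹ : ℂ)); ∀ Ψ :
Literature.MathematicalPhysics.QuantumManyBody.BoseGas.TrialState (n + 1) L,
Literature.MathematicalPhysics.QuantumManyBody.BoseGas.energy v Ψ + ENNReal.ofReal κ * ((n + 1 :
ENNReal) - Literature.MathematicalPhysics.QuantumManyBody.BoseGas.occupation (n + 1) g Ψ.ψ) ≤ (⨅ Φ :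
Literature.MathematicalPhysics.QuantumManyBody.BoseGas.TrialState (n + 1) L,
Literature.MathematicalPhysics.QuantumManyBody.BoseGas.energy v Φ + ENNReal.ofReal κ * ((n + 1 :
ENNReal) - Literature.MathematicalPhysics.QuantumManyBody.BoseGas.occupation (n + 1) g Φ.ψ)) + δ →
ENNReal.ofReal (c * (n + 1)) ≤ Literature.MathematicalPhysics.QuantumManyBody.BoseGas.maxOccupation
(n + 1) Ψ.ψ) → Literature.MathematicalPhysics.QuantumManyBody.BoseGas.HasGroundStateBEC v ρ)`

## Assembly
Pure logic plus L³ = N/ρ (tree lemma div_sideLength_pow_three) and sideLength ρ N → ∞: fix v;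
ShellPenetration gives ρ₀¹ and, for
ρ < ρ₀¹, (w, κ, c) and eventually-in-N near-minimiser sets on which penetration holds with ⟨g,γg⟩ >
0; PenetrationForcesCondensation
(with these c, w, instantiated at L = (N/ρ)^{1/3} ≥ L₀) upgrades this to λ_max(γ_Ψ) ≥ c'L³ = (c'/ρ)N
on the same sets, which is the
antecedent of ReservoirRemoval at (ρ, w, κ); its ρ₀² gives HasGroundStateBEC v ρ for ρ < min(ρ₀¹,
ρ₀²) — the conjunct. The two lattice
cruxes are the anchor and the engine (calibration of the criterion where every ingredient is a
theorem); they are not hypotheses of the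
assembly.

Rationale: WHY THIS LINE. Lebowitz's 1972 definition of a phase transition — order is sensitivity to the
boundary — transplanted to bosons: instead of a vanishing
BULK quasi-average source (LSSY2005 App. D; refuted in this programme as card
bosonic-lee-yang-quasiaverage on uncoupled blocks) a
FIXED-strength condensate reservoir on the boundary, with the order parameter read at the centre, so
that condensation becomes a
proximity / stiffness statement across the bulk and a single limit L → ∞ (LebowitzMartinlof1972,
Lebowitz1977; BricmontFontaineLandau1977,
MessagerMiraclesolePfister1978 for rotators). The library has no Fock space, so the coherent source
λ∫_∂(a + a†) is replaced by its
number-conserving parent — a macroscopically occupied reservoir mode g coupled through the physical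
kinetic hopping across the inner face
of the shell — which c-number substitution (LiebSeiringerYngvason2005) turns back into the card's
source of strength ∝ √ρ_shell; the
order parameter |⟨1_B, γ g⟩|²/⟨g, γ g⟩ is the U(1)-invariant shadow of |⟨a(x)⟩|², typable today over
BoseGas.energy/occupation.
Imported: correlation-inequality / boundary-condition theory of symmetry breaking (GKS–Ginibre,
Lee–Yang: Ginibre1970, Asano1970,
SuzukiFisher1971, BenassiLeesUeltschi2016) as the ANCHOR where every joint is a theorem or a proved
tree fact (KLS1988PRL =
kennedy_lieb_shastry_xy_thermal_holds, KomaTasaki1994): BenassiLeesUeltschi2016 §2 construct exactly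
the `+` boundary-condition state of
the spin-½ XY model (= hard-core lattice bosons at half filling) and leave its spontaneous
magnetisation open ("much work remains to be
done"); crux BoundaryFieldMagnetisation is that statement, crux LatticeSourceGriffiths its engine
off half filling. No prior route of the
sub-problem (51 Theses files grepped: BECPinning pins the BULK mode, BECFillingMonotone compares
sectors, BECThermalMonotonicity is
Griffiths in β, BECRewardWalk a U(1)-invariant bulk reward) uses an off-diagonal boundary datum;
negatives index (2 items) untouched.

RANKED CRUXES. #2 ShellPenetration (crux) — (card K1, PENETRATION) for every repulsive finite-range
v there is ρ₀ > 0 such that for 0 < ρ < ρ₀ there are a shell width w, a pinning strength κ and c > 0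
with: for all large N = n+1 (L = (N/ρ)^{1/3}, g = normalised indicator of the boundary shell of
width w) and some δ > 0, every δ-near-minimiser Ψ of the pinned energy ⟨Ψ,H_NΨ⟩ + κ(N − ⟨g,γ_Ψ g⟩)
has ⟨g,γ_Ψ g⟩ > 0 and, for every unit ball B(z,1) with centre coordinates in [2w+1, L−2w−1],
c·⟨g,γ_Ψ g⟩ ≤ |⟨1_{B(z,1)}, γ_Ψ g⟩|² (γ_Ψ the one-particle density matrix; intended regime 8πaρ < κ
≪ a⁻², w ≫ (8πaρ)^{-1/2}). [difficulty: open-problem] (why it might fail: it is ODLRO across the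
bulk in disguise: no tool controls phase coherence at distance L/2 from Dirichlet-type data beyond
c-number/GP + spin waves (the d = 3 infrared problem); and a too-strong κ makes a dense, non-dilute
shell whose healing layer could exceed any fixed w.) [LSSY2005, LebowitzMartinlof1972,
LiebSeiringerYngvason2005, PenroseOnsager1956, PitaevskiiStringari1991]
#3 BoundaryFieldMagnetisation (crux) — (card P1, the ANCHOR: Lebowitz–Martin-Löf for hard-core
lattice bosons at half filling) for every d ≥ 3 there is β₀ such that for β ≥ β₀ there is c > 0
with: for EVERY L ≥ 1, in the Gibbs state of BenassiLeesUeltschi2016's `+` boundary-condition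
Hamiltonian H⁺_L = −Σ_{⟨xy⟩ ⊂ {−L..L}^d}(S⁰_xS⁰_y + S¹_xS¹_y) − ½ Σ_x n_x S⁰_x (n_x = number of
exterior neighbours of x; their Prop. 4 with J = 1) the origin is magnetised: ⟨S⁰_0⟩⁺_{L,β} ≥ c.
Route to it: ⟨S⁰_0⟩⁺_L ↓ m⁺ (BLU Thm 5), m⁺ ≥ m* = lim_{h↓0} ∂p/∂h (GKS-II + differentiability of
the pressure for h > 0 from the Lee–Yang theorem for the anisotropic spin-½ ferromagnet with the
field along a dominant axis, J_field ≥ |J_other|, equality allowed — the N = 3 dominance condition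
(1.12) recorded by Lieb–Sokal, book:liebnd-statistical-mechanics p. 94), m* ≥ √2·σ_KLS > 0
(KomaTasaki1994 from kennedy_lieb_shastry_xy_thermal_holds). [difficulty: L] (why it might fail: the
XY model with in-plane field sits exactly on the boundary J_field = J_⊥ of the Asano/Suzuki–Fisher
dominance condition; if the pressure had a kink at some h > 0 the sandwich m⁺ ≥ m* breaks, and the
infinite-volume half of Koma–Tasaki (torus LRO ⇒ m* > 0) is not in the tree.)
[BenassiLeesUeltschi2016, LebowitzMartinlof1972, Asano1970, SuzukiFisher1971, KomaTasaki1994,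
KLS1988PRL, book:liebnd-statistical-mechanics]
#4 LatticeSourceGriffiths (crux) — (card K2, SOURCE-GRIFFITHS off the particle–hole point; the
engine that makes the boundary-source limit monotone at every filling) for the spin-½ XY model H =
−Σ_{⟨xy⟩}(S⁰_xS⁰_y + S¹_xS¹_y) − μ Σ_x S²_x − Σ_x h_x S⁰_x on the box {−L,…,L}^d ⊂ ℤ^d with free
boundary condition, chemical potential μ ∈ ℝ (filling dial) and nonnegative in-plane fields h, the
Gibbs expectation ⟨S⁰_x⟩_β is non-decreasing in every h_y: h ≤ h' sitewise ⟹ ⟨S⁰_x⟩_{β,μ,h} ≤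
⟨S⁰_x⟩_{β,μ,h'} for all β > 0, d, L, x. At μ = 0 this is BenassiLeesUeltschi2016 Cor. 2 (fields =
couplings with |A| = 1); μ ≠ 0 leaves Ginibre's cone. [difficulty: M] (why it might fail: μS² = −2i
S⁰S¹ has no sign in Ginibre's cone, so off half filling nothing is known; monotonicity in the
HOPPING is already false on 4×4 tori (card hopping-nonmonotone-coherence-census) and quantum
Griffiths II fails in general (Hurst–Sherman); one thermal 3×3 ED with μ ≠ 0 could kill it.)
[BenassiLeesUeltschi2016, arXiv:1510.03215, Ginibre1970, doi:10.1103/physrevlett.22.1357]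
#5 ReservoirRemoval (crux) — (card K3, "⟹") for every repulsive finite-range v there is ρ₀ > 0 such
that for all 0 < ρ < ρ₀, w > 0, κ > 0: if the δ-near-minimisers of the shell-pinned energy at (ρ, w,
κ) eventually have λ_max(γ_Ψ) ≥ cN for some c > 0, then HasGroundStateBEC v ρ (bare Dirichlet ground
state). Removing an O(L²) boundary reservoir does not destroy a bulk condensate — the bosonic
analogue of Lebowitz's ⟨σ₀σ_x⟩^free = ⟨σ₀σ_x⟩^+ ≥ (m⁺)². [deps: ShellPenetration] [difficulty: L]
(why it might fail: BEC is boundary-condition sensitive (Robinson1976: attractive walls pull the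
free-gas condensate into a surface state); pinned and bare ground states differ by an O(L²) wall
energy ≫ any gap, and no transfer tool (Lee–Yang continuity in the source) exists off the lattice —
(D.19) moved to the wall.) [Robinson1976, LSSY2005, Lebowitz1977, LebowitzMartinlof1972]
#9 PenetrationForcesCondensation (support) — (Bessel/Cauchy–Schwarz glue) for c, w > 0 there are c'
> 0 and L₀ with: for every N = n+1, every L ≥ L₀ and every trial state Ψ on Λ_L with ⟨g,γ_Ψ g⟩ > 0
and c·⟨g,γ_Ψ g⟩ ≤ |⟨1_{B(z,1)},γ_Ψ g⟩|² for all ball centres z ∈ [2w+1, L−2w−1]³, one has λ_max(γ_Ψ)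
≥ c'L³: indeed λ_max ≥ ⟨g,γ²g⟩/⟨g,γg⟩ ≥ Σ_{disjoint balls} |⟨1_B,γ g⟩|²/(|B|⟨g,γg⟩) ≥
(c/|B|)·((L−4w−2)/2)³ (c' = c/(64|B|), |B| = 4π/3, L₀ = 8w+4). [difficulty: provable-now]
[PenroseOnsager1956, LSSY2005]

TWO-LAYER PLAN. Foreseen glued splits, none filed now (k ≤ 3, depth 1): ShellPenetration ⇐
ReservoirFilled (κ-pinning puts ≥ ρ_*|S_w| particles
coherently into g: trial state + concavity of E^κ in κ, provable) → InterfaceLocking (coherence of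
the first bulk layer with g:
Josephson energy across the inner face versus phase-gradient cost) → BulkStiffness (coherence does
not decay from the first layer to the
centre: the d = 3 Dirichlet phase field) → ShellPenetration. BoundaryFieldMagnetisation ⇐
PlusStateMonotone (BLU Thm 5 in Lean:
⟨S⁰_0⟩⁺_L non-increasing in L, GKS-II) → PressureDifferentiable (Lee–Yang for spin-½ XY with
in-plane field ⇒ p(β,h) real-analytic
on h > 0) → QuasiAverageFromLRO (Koma–Tasaki / Griffiths: torus LRO ⇒ lim_{h↓0}∂p/∂h ≥ √2 σ) →
BoundaryFieldMagnetisation.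
ReservoirRemoval ⇐ DomainMonotone (bulk coherence non-increasing when the reservoir recedes,
continuum GKS) → WallContinuity (no jump
at κ = 0⁺ for cubes) → ReservoirRemoval. LatticeSourceGriffiths, if it dies thermally, is re-filed
for ground states / boundary-supported
fields only (1:1 restate).

KILL CRITERIA. ¬ShellPenetration for some admissible v at all small ρ and EVERY (w, κ) — e.g. a
proof that pinned near-minimisers fragment (shell and
bulk condense into orthogonal modes) or that bulk coherence with g decays in L — closes the route
`refuted:ShellPenetration` (the line IS
this inequality). ¬BoundaryFieldMagnetisation (m⁺ = 0 for the quantum XY `+` state despite KLS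
order) refutes the boundary-source
geometry on its own anchor: close. ¬LatticeSourceGriffiths by a certified thermal ED witness forces
a pivot of the engine only
(route edit --restate to ground states / boundary-supported fields); a ground-state witness as well
demotes "monotone single limit" to a
heuristic but leaves the assembly intact. ReservoirRemoval is implied by the conjunct and cannot die
alone. BoseEinsteinCondensation or
HasGroundStateBEC-for-small-ρ proved elsewhere moots ranks 2 and 5; BoundaryFieldMagnetisation keeps
its value as a Literature theorem.

NOT DECOMPOSED YET. The genuine U(1)-breaking version (Fock space, H − λ∫_{S_w}(a + a†),
grand-canonical μ(ρ)) — the card's D1; deliberately replaced by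
the number-conserving shell reservoir, to be requested only if a prover needs it. Continuum
source-Griffiths (monotonicity of the bulk
coherence in κ and in the domain — the card's "single monotone limit"; filed on the lattice as rank
4 where it is falsifiable in
minutes). The full Lebowitz–Martin-Löf identity m⁺ = m* and uniqueness-iff-m* = 0 for the quantum XY
model (only m⁺ ≥ m* > 0 is
filed). The ground-state (d ≥ 2) version of the anchor (needs differentiability of e₀(h), not given
by Lee–Yang). The loop
dictionary lemma P2 of the card (in-plane field = cosh length-tilt of Ueltschi2013 loops; chemical
potential = signed flips) —
commentary for route BECFillingMonotone, not an item. Constants c, κ, w as functions of (v, ρ);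
positive temperature in the continuum.

CHEAPEST FALSIFIER. Thermal exact diagonalisation of LatticeSourceGriffiths: boxes 2×2, 3×2, 3×3 (2⁹
states), 2×2×2, chemical potential
μ ∈ {±0.5, ±1, ±2, ±3}, β ∈ {0.3, 1, 3, 10}, fields h ≤ h' drawn nonnegative at random (and the
route's geometry: h' = h + t·1_{y}
for boundary y, x = centre): any decrease of ⟨S⁰_x⟩ beyond 1e-10 kills rank 4 (minutes of numpy; not
run in this one-shot planner
seat — the card's triage ran the ground-state 2- and 3-site version, 26 scans, all monotone).
Second: worm/SSE QMC (sign-free, the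
pinning is diagonal-plus-stoquastic) of hard-core bosons on L³, L = 6…16, fillings ¼…½ with boundary
in-plane field: ⟨S⁰_centre⟩
versus L. Literature lookup that would downgrade rank 3 to known: a printed "m⁺ = m*" / uniqueness
theorem for the quantum XY model
(searched, not found; BenassiLeesUeltschi2016 state it as open).

NUMBERS. Shell: |S_w| = L³ − (L−2w)³ ≈ 6wL²; mean-field shell density under pinning ρ_sh ≈ (κ +
8πaρ)/(8πa), so the intended window is
8πaρ < κ ≪ a⁻² (dilute shell), w ≫ ξ = (8πaρ)^{-1/2} (healing length); reservoir occupation ⟨g,γg⟩ ≈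
ρ_sh|S_w| = O(N^{2/3}), never
macroscopic by itself. Heuristic value of the penetration constant: c ≈ ρ₀^{bulk}·|B|², |B| = 4π/3.
Bessel step: c' = c/(64|B|),
L₀ = 8w + 4, giving condensate fraction ≥ c/(64|B|ρ). Ideal gas v = 0: rank 2 holds iff κ is below
the binding threshold of
−Δ_D − κ|g⟩⟨g| (order w⁻²); above it the whole gas falls into the shell (Robinson1976's phenomenon)
— the ∃κ lets the prover stay below.
Anchor: BLU `+` field = ½ per missing neighbour (Prop. 4, J = 1, S = ½); m⁺ ≥ m* ≥ √2·σ with σ² the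
KLS/DLS long-range-order constant
of kennedy_lieb_shastry_xy_thermal (d = 3, β ≥ β₀). Items at open: 6 (4 cruxes, 1 support, 1
assembly).

DEFINITION REQUESTS. None filed. Everything is typed over
Literature.MathematicalPhysics.QuantumManyBody.BoseGas.{IsRepulsiveFiniteRange, sideLength,
TrialState, energy, occupation, maxOccupation, HasGroundStateBEC, BoseEinsteinCondensation},
Literature.MathematicalPhysics.QuantumLattice.{Op,
xxzHamiltonian, siteSpin, totalSpin}, Matrix.gibbsState, Literature.Probability.LatticeModels.{box,
zero_mem_box, zdGraph, Site}
(all `lean search`-verified; Sketch.lean rc 0). The card's D1 (FockDirichletSourceState: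
grand-canonical Dirichlet trial families with a
boundary coherent source) is NOT requested — see Not decomposed yet. Bib entries added for
SuzukiFisher1971 and BricmontFontaineLandau1977.

Novelty: Searches (2026-08-15): `lit frontier AtomisticToContinuum --since 2020` (30 rows: energy expansions
/ Neumann localisation —
arXiv:2603.20776, arXiv:2510.20493, arXiv:2602.16566 — nothing on boundary data or sources); `lit
bridges AtomisticToContinuum --cross any`
(30 rows, none relevant); `lit galaxy search --star all` for "uniqueness of the equilibrium state
quantum XY model" (0), "Griffiths
inequalities for the quantum XY" (0), "proximity effect Bose" (0), "Zeros of the Partition Function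
for the Heisenberg" (0), `--star panama
"Lee-Yang theorem"` (5 books: Rice–Freed, Friedli–Velenik, Glimm–Jaffe ×2, Stanley); local hybrid
"Lee-Yang theorem anisotropic Heisenberg
Suzuki Fisher" (12 books; book:liebnd-statistical-mechanics pp. 54, 93–94 read: Lieb–Sokal (1.12)
records the N = 3 dominance condition
J_field ≥ max|J_other| "known by entirely different methods" = Asano / Suzuki–Fisher); `lit read
arXiv:1510.03215` pp. 3–4 (Thm 1, Cor 2,
Prop 4, Thm 5 and the closing "much work remains to be done"); remote cascade (searchd) returned rc
75 throughout the session — recorded,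
not worked around; the card's own searches (galaxy ×5, hybrid, in-pool grep of 125 cards) inherited.
Nearest prior art found: LebowitzMartinlof1972 / Lebowitz1977 (Ising: ⟨σ₀⟩⁺ = m*, two-point
functions b.c.-independent);
BricmontFontaineLandau1977, MessagerMiraclesolePfister1978 (plane rotators via Ginibre + Lee–Yang);
BenassiLeesUeltschi2016 §2 (the `+`
state of the quantum XY model, magnetisation left open  [refs: 2603.20776, 2510.20493, 2602.16566, 1510.03215, book:liebnd-statistical-mechanics, LebowitzMartinlof1972, Lebowitz1977, BricmontFontaineLandau1977, MessagerMiraclesolePfister1978, BenassiLeesUeltschi2016, LSSY2005, LiebSeiringerYngvason2005]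

Barriers (technique_class: boundary-source correlation-inequality Lee-Yang proximity): - technique_class: boundary-source correlation-inequality Lee-Yang proximity
- Literature.Barriers.AtomisticToContinuum.SymmetryBreakingWithoutCondensate: evaded in letter — no
source is sent to 0 after V → ∞, the reservoir strength κ is fixed, the transferred quantity is a
macroscopic EIGENVALUE of γ of a particle-conserving state (not a tilt/first moment of a
coherent-state weight), and the geometry-free weight (D.19) cannot model a boundary-supported
reservoir whose influence must cross the bulk; conceded in spirit at ReservoirRemoval, which needs
model-specific input (bulk insensitivity to an O(L²) wall term) exactly where the entry says
"additional model-specific input" is required.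
- Literature.Barriers.AtomisticToContinuum.SymmetryBreakingWithoutCondensateNarrow: its witness is
the free gas in boxes with one dominant edge at T > 0 (type III); the route works in cubes at T = 0
with repulsion, and the ∃κ clause keeps the ideal-gas degenerate case (v = 0) on the true side
(Numbers).
- Literature.Barriers.AtomisticToContinuum.CasimirBoxGeneralizedCondensation: shape-regular boxes
only (cubes (N/ρ)^{1/3}); generalized/type-III condensation in slabs is not claimed or used.
- Literature.Barriers.AtomisticToContinuum.HalfFillingReflectionPositivity: reflection positivity
enters only through the PROVED tree fact kennedy_lieb_shastry_xy_thermal_holds inside the anchor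
(rank 3, at half filling, within the entry's scope); ranks 2, 4, 5 use no reflection; leaving half
filling is at

History (route lifecycle, newest last):
- 2026-08-23T04:20:26Z · DORMANT — reconciler: no traction for 5.9 d (last activity item-evidence-added at 2026-08-17T06:20:02Z); parked, not closed — `ledger route dormant route-AtomisticToConti (operator:999:1133476)

sub-problem: BoseEinsteinCondensation · status: dormant · opened planner-plancard-AtomisticToContinuum-BoseEin-4454324a-0 2026-08-15T13:30:56Z · rev 3 · ledger route-AtomisticToContinuum-BECBoundaryReservoir
GENERATED by the gate from the ledger (D-0016/17). Provers cite these decls: `theorem foo : Summit.AtomisticToContinuum.BoseEinsteinCondensation.Theses.BECBoundaryReservoir.<Decl> := …` in Summits/AtomisticToContinuum/BoseEinsteinCondensation/Theorems/<Name>.lean.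
-/

namespace Summit.AtomisticToContinuum.BoseEinsteinCondensation.Theses.BECBoundaryReservoir

open scoped BigOperators Topology Manifold Classical MeasureTheory ProbabilityTheory Matrix InnerProductSpace ComplexConjugate ContinuousMap
open Filter Set Function TopologicalSpace MeasureTheory

attribute [summit_statement] _root_.BoseEinsteinCondensation

/-- item stmt-AtomisticToContinuum-8767 · crux · rank 2 · open · by planner
why it might fail: ODLRO across the bulk in disguise: no tool controls phase coherence at distance L/2 from boundary data beyond GP+Bogoliubov heuristics (d=3 infrared problem). And ∀v admits v≡0, where −Δ_D−κ|g⟩⟨g| is sine-like for κ<κ_c(w)≈3/w² (fails at balls near faces), shell-bound for κ>κ_c: only resonant κ.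
sources: LSSY2005, LiebSeiringerYngvason2005, PenroseOnsager1956, PitaevskiiStringari1991, Robinson1976, LebowitzMartinlof1972
[crux] (card K1, PENETRATION) for every repulsive finite-range v there is ρ₀ > 0 such that for 0 < ρ
< ρ₀ there are a shell width w, a pinning strength κ and c > 0 with: for all large N = n+1 (L =
(N/ρ)^{1/3}, g = normalised indicator of the boundary shell of width w) and some δ > 0, every
δ-near-minimiser Ψ of the pinned energy ⟨Ψ,H_NΨ⟩ + κ(N − ⟨g,γ_Ψ g⟩) has ⟨g,γ_Ψ g⟩ > 0 and, for every
unit ball B(z,1) with centre coordinates in [2w+1, L−2w−1], c·⟨g,γ_Ψ g⟩ ≤ |⟨1_{B(z,1)}, γ_Ψ g⟩|²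
(γ_Ψ the one-particle density matrix; intended regime 8πaρ < κ ≪ a⁻², w ≫ (8πaρ)^{-1/2}).
[difficulty: open-problem] -/
@[route_item "route-AtomisticToContinuum-BECBoundaryReservoir", crux]
def ShellPenetration : Prop :=
  ∀ v : ℝ → ENNReal, Literature.MathematicalPhysics.QuantumManyBody.BoseGas.IsRepulsiveFiniteRange v → ∃ ρ₀ : ℝ, 0 < ρ₀ ∧ ∀ ρ : ℝ, 0 < ρ → ρ < ρ₀ → ∃ w κ c : ℝ, 0 < w ∧ 0 < κ ∧ 0 < c ∧ ∀ᶠ n : ℕ in Filter.atTop, ∃ δ : ENNReal, 0 < δ ∧ let L : ℝ := Literature.MathematicalPhysics.QuantumManyBody.BoseGas.sideLength ρ (n + 1); let g : EuclideanSpace ℝ (Fin 3) → ℂ := Set.indicator {x | (∀ k, x k ∈ Set.Ioo 0 L) ∧ ∃ k, x k ≤ w ∨ L - w ≤ x k} (fun _ => ((Real.sqrt (L ^ 3 - (L - 2 * w) ^ 3))⁻¹ : ℂ)); ∀ Ψ : Literature.MathematicalPhysics.QuantumManyBody.BoseGas.TrialState (n + 1) L, Literature.MathematicalPhysics.QuantumManyBody.BoseGas.energy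 v Ψ + ENNReal.ofReal κ * ((n + 1 : ENNReal) - Literature.MathematicalPhysics.QuantumManyBody.BoseGas.occupation (n + 1) g Ψ.ψ) ≤ (⨅ Φ : Literature.MathematicalPhysics.QuantumManyBody.BoseGas.TrialState (n + 1) L, Literature.MathematicalPhysics.QuantumManyBody.BoseGas.energy v Φ + ENNReal.ofReal κ * ((n + 1 : ENNReal) - Literature.MathematicalPhysics.QuantumManyBody.BoseGas.occupation (n + 1) g Φ.ψ)) + δ → 0 < Literature.MathematicalPhysics.QuantumManyBody.BoseGas.occupation (n + 1) g Ψ.ψ ∧ ∀ z : EuclideanSpace ℝ (Fin 3), (∀ k, z k ∈ Set.Icc (2 * w + 1) (L - 2 * w - 1)) → c * (Literature.MathematicalPhysics.QuantumManyBody.BoseGas.occupation (n + 1) g Ψ.ψ).toReal ≤ ‖(n + 1 : ℂ) * ∫ Y : Fin n → EuclideanSpace ℝ (Fin 3), (∫ x in Metric.ball z 1, Ψ.ψ (Matrix.vecCons x Y)) * conj (∫ x, conj (g x) * Ψ.ψ (Matrix.vecCons x Y))‖ ^ 2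

/-- item stmt-AtomisticToContinuum-8769 · crux · rank 4 · open · by planner
why it might fail: μS² = −2i S⁰S¹ leaves Ginibre's cone, so off half filling nothing is known; GKS-II fails for some quantum ferromagnets (HurstSherman1969) and monotonicity in the HOPPING is already false on 4×4 tori (card hopping-nonmonotone-coherence-census); one thermal 3×3 ED with μ ≠ 0 could kill it.
sources: BenassiLeesUeltschi2016, arXiv:1510.03215, Ginibre1970, HurstSherman1969, doi:10.1103/physrevlett.22.1357
[crux] (card K2, SOURCE-GRIFFITHS off the particle–hole point; the engine that makes the
boundary-source limit monotone at every filling) for the spin-½ XY model H = −Σ_{⟨xy⟩}(S⁰_xS⁰_y +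
S¹_xS¹_y) − μ Σ_x S²_x − Σ_x h_x S⁰_x on the box {−L,…,L}^d ⊂ ℤ^d with free boundary condition,
chemical potential μ ∈ ℝ (filling dial) and nonnegative in-plane fields h, the Gibbs expectation
⟨S⁰_x⟩_β is non-decreasing in every h_y: h ≤ h' sitewise ⟹ ⟨S⁰_x⟩_{β,μ,h} ≤ ⟨S⁰_x⟩_{β,μ,h'} for all
β > 0, d, L, x. At μ = 0 this is BenassiLeesUeltschi2016 Cor. 2 (fields = couplings with |A| = 1); μ
≠ 0 leaves Ginibre's cone. [difficulty: M] -/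
@[route_item "route-AtomisticToContinuum-BECBoundaryReservoir"]
def LatticeSourceGriffiths : Prop :=
  ∀ (d L : ℕ) (β μ : ℝ), 0 < β → ∀ h h' : ↥(Literature.Probability.LatticeModels.box d L) → ℝ, (∀ y, 0 ≤ h y ∧ h y ≤ h' y) → ∀ x : ↥(Literature.Probability.LatticeModels.box d L), let H : (↥(Literature.Probability.LatticeModels.box d L) → ℝ) → Literature.MathematicalPhysics.QuantumLattice.Op ↥(Literature.Probability.LatticeModels.box d L) 2 := fun f => Literature.MathematicalPhysics.QuantumLattice.xxzHamiltonian 1 ((Literature.Probability.LatticeModels.zdGraph d).comap Subtype.val) (-1) 0 - (μ : ℂ) • Literature.MathematicalPhysics.QuantumLattice.totalSpin 1 2 - ∑ y, (f y : ℂ) • Literature.MathematicalPhysics.QuantumLattice.siteSpin 1 y 0; (Matrix.gibbsState β (H h) (Literature.MathematicalPhysics.QuantumLattice.siteSpin 1 x 0)).re ≤ (Matrix.gibbsState β (H h') (Literature.MathematicalPhysics.QuantumLattice.siteSpin 1 x 0)).re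

/-- item stmt-AtomisticToContinuum-8768 · crux · rank 5 · open · by planner
why it might fail: BEC is boundary-condition sensitive (Robinson1976: attractive walls pull the free-gas condensate into a surface state); pinned and bare ground states differ by an O(L²) wall energy ≫ any gap, and no transfer tool (Lee–Yang-type continuity in the source, LSSY (D.19)) exists off the lattice.
sources: Robinson1976, LSSY2005, Lebowitz1977, LebowitzMartinlof1972
[crux] (card K3, "⟹") for every repulsive finite-range v there is ρ₀ > 0 such that for all 0 < ρ <
ρ₀, w > 0, κ > 0: if the δ-near-minimisers of the shell-pinned energy at (ρ, w, κ) eventually have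
λ_max(γ_Ψ) ≥ cN for some c > 0, then HasGroundStateBEC v ρ (bare Dirichlet ground state). Removing
an O(L²) boundary reservoir does not destroy a bulk condensate — the bosonic analogue of Lebowitz's
⟨σ₀σ_x⟩^free = ⟨σ₀σ_x⟩^+ ≥ (m⁺)². [deps: ShellPenetration] [difficulty: L] -/
@[route_item "route-AtomisticToContinuum-BECBoundaryReservoir", crux]
def ReservoirRemoval : Prop :=
  ∀ v : ℝ → ENNReal, Literature.MathematicalPhysics.QuantumManyBody.BoseGas.IsRepulsiveFiniteRange v → ∃ ρ₀ : ℝ, 0 < ρ₀ ∧ ∀ ρ w κ : ℝ, 0 < ρ → ρ < ρ₀ → 0 < w → 0 < κ → (∃ c : ℝ, 0 < c ∧ ∀ᶠ n : ℕ in Filter.atTop, ∃ δ : ENNReal, 0 < δ ∧ let L : ℝ := Literature.MathematicalPhysics.QuantumManyBody.BoseGas.sideLength ρ (n + 1); let g : EuclideanSpace ℝ (Fin 3) → ℂ := Set.indicator {x | (∀ k, x k ∈ Set.Ioo 0 L) ∧ ∃ k, x k ≤ w ∨ L - w ≤ x k} (fun _ => ((Real.sqrt (L ^ 3 - (L - 2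 * w) ^ 3))⁻¹ : ℂ)); ∀ Ψ : Literature.MathematicalPhysics.QuantumManyBody.BoseGas.TrialState (n + 1) L, Literature.MathematicalPhysics.QuantumManyBody.BoseGas.energy v Ψ + ENNReal.ofReal κ * ((n + 1 : ENNReal) - Literature.MathematicalPhysics.QuantumManyBody.BoseGas.occupation (n + 1) g Ψ.ψ) ≤ (⨅ Φ : Literature.MathematicalPhysics.QuantumManyBody.BoseGas.TrialState (n + 1) L, Literature.MathematicalPhysics.QuantumManyBody.BoseGas.energy v Φ + ENNReal.ofReal κ * ((n + 1 : ENNReal) - Literature.MathematicalPhysics.QuantumManyBody.BoseGas.occupation (n + 1) g Φ.ψ)) + δ → ENNReal.ofReal (c * (n + 1)) ≤ Literature.MathematicalPhysics.QuantumManyBody.BoseGas.maxOccupation (n + 1) Ψ.ψ) → Literature.MathematicalPhysics.QuantumManyBody.BoseGas.HasGroundStateBEC v ρ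

/-- item stmt-AtomisticToContinuum-8770 · support · rank 3 · open · by planner
why it might fail: the XY model with in-plane field sits exactly on the boundary J_field = J_⊥ of the Asano/Suzuki–Fisher dominance condition; if the pressure had a kink at some h > 0 the sandwich m⁺ ≥ m* breaks, and the infinite-volume half of Koma–Tasaki (torus LRO ⇒ m* > 0) is not in the tree.
sources: BenassiLeesUeltschi2016, KomaTasaki1993, DysonLiebSimon1978, KLS1988PRL, Griffiths1966, LebowitzMartinlof1972
[crux] (card P1, the ANCHOR: Lebowitz–Martin-Löf for hard-core lattice bosons at half filling) for
every d ≥ 3 there is β₀ such that for β ≥ β₀ there is c > 0 with: for EVERY L ≥ 1, in the Gibbs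
state of BenassiLeesUeltschi2016's `+` boundary-condition Hamiltonian H⁺_L = −Σ_{⟨xy⟩ ⊂
{−L..L}^d}(S⁰_xS⁰_y + S¹_xS¹_y) − ½ Σ_x n_x S⁰_x (n_x = number of exterior neighbours of x; their
Prop. 4 with J = 1) the origin is magnetised: ⟨S⁰_0⟩⁺_{L,β} ≥ c. Route to it: ⟨S⁰_0⟩⁺_L ↓ m⁺ (BLU
Thm 5), m⁺ ≥ m* = lim_{h↓0} ∂p/∂h (GKS-II + differentiability of the pressure for h > 0 from the
Lee–Yang theorem for the anisotropic spin-½ ferromagnet with the field along a dominant axis,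
J_field ≥ |J_other|, equality allowed — the N = 3 dominance condition (1.12) recorded by Lieb–Sokal,
book:liebnd-statistical-mechanics p. 94), m* ≥ √2·σ_KLS > 0 (KomaTasaki1994 from
kennedy_lieb_shastry_xy_thermal_holds). [difficulty: L] -/
@[route_item "route-AtomisticToContinuum-BECBoundaryReservoir"]
def BoundaryFieldMagnetisation : Prop :=
  ∀ d : ℕ, 3 ≤ d → ∃ β₀ : ℝ, 0 < β₀ ∧ ∀ β : ℝ, β₀ ≤ β → ∃ c : ℝ, 0 < c ∧ ∀ L : ℕ, 1 ≤ L → c ≤ (Matrix.gibbsState β (Literature.MathematicalPhysics.QuantumLattice.xxzHamiltonian 1 ((Literature.Probability.LatticeModels.zdGraph d).comap Subtype.val) (-1) 0 - ∑ x : ↥(Literature.Probability.LatticeModels.box d L), (((Finset.univ.filter fun i : Fin d => (x : Literature.Probability.LatticeModels.Site d) i = (L : ℤ) ∨ (x : Literature.Probability.LatticeModels.Site d) i = -(L : ℤ)).card : ℂ) / 2) • Literature.MathematicalPhysics.QuantumLattice.siteSpin 1 x 0) (Literature.MathematicalPhysics.QuantumLattice.siteSpin 1 (⟨0, Literature.Probability.LatticeModels.zero_mem_box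 d L⟩ : ↥(Literature.Probability.LatticeModels.box d L)) 0)).re

/-- item stmt-AtomisticToContinuum-8771 · support · rank 9 · open · by planner
sources: PenroseOnsager1956, LSSY2005
[support] (Bessel/Cauchy–Schwarz glue) for c, w > 0 there are c' > 0 and L₀ with: for every N = n+1,
every L ≥ L₀ and every trial state Ψ on Λ_L with ⟨g,γ_Ψ g⟩ > 0 and c·⟨g,γ_Ψ g⟩ ≤ |⟨1_{B(z,1)},γ_Ψ
g⟩|² for all ball centres z ∈ [2w+1, L−2w−1]³, one has λ_max(γ_Ψ) ≥ c'L³: indeed λ_max ≥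
⟨g,γ²g⟩/⟨g,γg⟩ ≥ Σ_{disjoint balls} |⟨1_B,γ g⟩|²/(|B|⟨g,γg⟩) ≥ (c/|B|)·((L−4w−2)/2)³ (c' =
c/(64|B|), |B| = 4π/3, L₀ = 8w+4). [difficulty: provable-now] -/
@[route_item "route-AtomisticToContinuum-BECBoundaryReservoir", crux]
def PenetrationForcesCondensation : Prop :=
  ∀ c w : ℝ, 0 < c → 0 < w → ∃ c' L₀ : ℝ, 0 < c' ∧ ∀ (n : ℕ) (L : ℝ), L₀ ≤ L → let g : EuclideanSpace ℝ (Fin 3) → ℂ := Set.indicator {x | (∀ k, x k ∈ Set.Ioo 0 L) ∧ ∃ k, x k ≤ w ∨ L - w ≤ x k} (fun _ => ((Real.sqrt (L ^ 3 - (L - 2 * w) ^ 3))⁻¹ : ℂ)); ∀ Ψ : Literature.MathematicalPhysics.QuantumManyBody.BoseGas.TrialState (n + 1) L, 0 < Literature.MathematicalPhysics.QuantumManyBody.BoseGas.occupation (n + 1) g Ψ.ψ → (∀ z : EuclideanSpace ℝ (Fin 3), (∀ k, z k ∈ Set.Icc (2 * w + 1) (L - 2 * w - 1)) → c * (Literature.MathematicalPhysics.QuantumManyBody.BoseGas.occupation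 (n + 1) g Ψ.ψ).toReal ≤ ‖(n + 1 : ℂ) * ∫ Y : Fin n → EuclideanSpace ℝ (Fin 3), (∫ x in Metric.ball z 1, Ψ.ψ (Matrix.vecCons x Y)) * conj (∫ x, conj (g x) * Ψ.ψ (Matrix.vecCons x Y))‖ ^ 2) → ENNReal.ofReal (c' * L ^ 3) ≤ Literature.MathematicalPhysics.QuantumManyBody.BoseGas.maxOccupation (n + 1) Ψ.ψ

/-- item stmt-AtomisticToContinuum-8772 · assembly · rank 1 · open · by planner
sources: LSSY2005, LebowitzMartinlof1972
[assembly] ShellPenetration → PenetrationForcesCondensation → ReservoirRemoval →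
BoseEinsteinCondensation. -/
@[route_item "route-AtomisticToContinuum-BECBoundaryReservoir"]
def Assembly : Prop :=
  ShellPenetration → PenetrationForcesCondensation → ReservoirRemoval → Literature.MathematicalPhysics.QuantumManyBody.BoseGas.BoseEinsteinCondensation

/-! D-0027 §2.1 — DECIDING THEOREM (planner-authored via `route open/edit --closes-file`; by planner-plancard-AtomisticToContinuum-BoseEin-4454324a-0 2026-08-15T13:57:19Z):
its hypotheses are this route's items and its conclusion the sub-problem Statement (glue_lint), and it elaborates with this file. -/

/-- Deciding theorem (D-0027 §2.1). Pure logic plus `L³ = N/ρ` (`div_sideLength_pow_three`) and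
`sideLength ρ N → ∞`: ShellPenetration supplies `(w, κ, c)` and eventual near-minimiser sets on which
the reservoir is occupied and penetration holds on every bulk unit ball; PenetrationForcesCondensation
(Bessel) upgrades this to `λ_max(γ_Ψ) ≥ c'L³ = (c'/ρ)N` on the same sets — the antecedent of
ReservoirRemoval, whose conclusion is the conjunct at every `ρ < min ρ₀¹ ρ₀²`. -/
@[closes "route-AtomisticToContinuum-BECBoundaryReservoir"] theorem closes : ShellPenetration → PenetrationForcesCondensation → ReservoirRemoval → BoseEinsteinCondensation := by
  intro hP hF hR v hv
  obtain ⟨ρ₁, hρ₁, hP⟩ := hP v hv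
  obtain ⟨ρ₂, hρ₂, hR⟩ := hR v hv
  refine ⟨min ρ₁ ρ₂, lt_min hρ₁ hρ₂, fun ρ hρ hρlt => ?_⟩
  obtain ⟨w, κ, c, hw, hκ, hc, hev⟩ := hP ρ hρ (hρlt.trans_le (min_le_left _ _))
  obtain ⟨c', L₀, hc', hF⟩ := hF c w hc hw
  refine hR ρ w κ hρ (hρlt.trans_le (min_le_right _ _)) hw hκ ⟨c' / ρ, div_pos hc' hρ, ?_⟩
  have hL : ∀ᶠ n : ℕ in Filter.atTop,
      L₀ ≤ Literature.MathematicalPhysics.QuantumManyBody.BoseGas.sideLength ρ (n + 1) := by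
    have ht : Filter.Tendsto
        (fun n : ℕ => Literature.MathematicalPhysics.QuantumManyBody.BoseGas.sideLength ρ (n + 1))
        Filter.atTop Filter.atTop := by
      unfold Literature.MathematicalPhysics.QuantumManyBody.BoseGas.sideLength
      refine (tendsto_rpow_atTop (by norm_num : (0 : ℝ) < 1 / 3)).comp ?_
      refine Filter.Tendsto.atTop_div_const hρ ?_
      exact tendsto_natCast_atTop_atTop.comp (Filter.tendsto_add_atTop_nat 1)
    exact ht.eventually_ge_atTop L₀
  filter_upwards [hev, hL] with n hn hLn
  obtain ⟨δ, hδ, hn⟩ := hn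
  refine ⟨δ, hδ, ?_⟩
  intro L g Ψ hΨ
  obtain ⟨hocc, hpen⟩ := hn Ψ hΨ
  have key := hF n L hLn Ψ hocc hpen
  have hNL : c' / ρ * ((n : ℝ) + 1) = c' * L ^ 3 := by
    have h3 := Literature.MathematicalPhysics.QuantumManyBody.BoseGas.div_sideLength_pow_three hρ
      (Nat.succ_pos n)
    have hL0 : (0 : ℝ) < L ^ 3 := by
      have hN : (0 : ℝ) < ((n + 1 : ℕ) : ℝ) := by exact_mod_cast Nat.succ_pos n
      rcases lt_or_ge 0 (L ^ 3) with hlt | hle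
      · exact hlt
      · have hq : ((n + 1 : ℕ) : ℝ) / L ^ 3 ≤ 0 := div_nonpos_of_nonneg_of_nonpos hN.le hle
        linarith
    rw [div_eq_iff hL0.ne'] at h3
    push_cast at h3
    field_simp
    linarith [h3]
  calc ENNReal.ofReal (c' / ρ * ((n : ℝ) + 1)) = ENNReal.ofReal (c' * L ^ 3) := by rw [hNL]
    _ ≤ _ := key

end Summit.AtomisticToContinuum.BoseEinsteinCondensation.Theses.BECBoundaryReservoir
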